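import Mathlib.Tactic
import HarnessLib
import HarnessLib.Audit.Tags
import Summits.CriticalPhenomena.PercolationContinuityZ3.Theorems.PercNearOneGluingNoHeavyLowerTailSahiAntichainSplit

/-!
# Antichains, meets plus joins: the difference-free projection

Support file (seat `prim-masterthm-p1`, gen 36; `--supports stmt-CriticalPhenomena-4575`).  No `sorry`, no new definitions, standard
axioms.  Companion of `…SahiAntichainDual` (complement duality).  Memo `run/shared/lean/prim/prim-masterthm/FROM-prim-masterthm-p1-g36-*.md`.

SETTING (files `…SahiAntichainSplit*`): `meets P` / `joins P` are the pairwise meets / joins of DISTINCT members of a finite family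
`P` of finite sets; conjecture V5 says an antichain has `#meets P + #joins P ≥ 2 #P − 2`.

NEW HERE ([this work], gen 36).  **Difference-free projection.**  If a set of points `R` contains no difference `a \ b` of two
distinct members, then `a ↦ a \ R` is injective on `P`, its image is again an antichain with `#P` members, and `#meets`, `#joins`
do not increase (`card_meets_image_sdiff_le`, `card_joins_image_sdiff_le`); hence V5 for the projected family implies V5 for `P`
(`two_mul_card_le_of_image_sdiff`), while the ground set shrinks to `(P.sup id) \ R` (`sup_image_sdiff`).  For an antichain and
`R = {r}` the hypothesis says exactly that `{r}` is not a difference `a \ b` (`dfree_singleton_iff`): so a counterexample to V5 on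
the fewest points has EVERY point of its ground set equal to a singleton difference of two members (`exists_sdiff_eq_singleton_or_dfree`)
— equivalently (`sdiff_eq_singleton_iff`) some member `a ∋ r` has `a.erase r ⊆ b` for another member `b ∌ r`, so that `a.erase r`
is a cross meet and `b ∪ {r}` a cross join at `r`.  Finally the `r`-side translate `(above P r).image (·.erase r)` keeps `#meets`,
`#joins`, size and the antichain property (`card_meets_image_erase_above`, `isAntichain_image_erase_above`), so BOTH halves of a
split live on fewer points than `P`: V5 follows by induction on the number of points from «every antichain has a good point
(`newLabels ≥ 2`), a difference-free point, or `#meets, #joins ≥ #P − 1`».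
HONEST FRAMING: V5 itself remains OPEN; everything here is unconditional bookkeeping. [this work]
-/

namespace Summit.CriticalPhenomena.PercolationContinuityZ3.Theorems.SahiColouredDaykin

open Finset

variable {α : Type*} [DecidableEq α]

/-! ### The difference-free projection `a ↦ a \ R` -/

section Project

variable {P : Finset (Finset α)} {R : Finset α} {r : α}

/-- Meets of the projected family are projections of meets. [this work] -/
theorem meets_image_sdiff_subset (P : Finset (Finset α)) (R : Finset α) :
    meets (P.image (· \ R)) ⊆ (meets P).image (· \ R) := by
  intro Z hZ
  obtain ⟨x, hx, y, hy, hxy, rfl⟩ := mem_meets_iff.1 hZ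
  obtain ⟨a, ha, rfl⟩ := mem_image.1 hx
  obtain ⟨b, hb, rfl⟩ := mem_image.1 hy
  refine mem_image.2 ⟨a ∩ b, mem_meets_iff.2 ⟨a, ha, b, hb, ?_, rfl⟩, (inf_sdiff)⟩
  rintro rfl; exact hxy rfl

/-- Joins of the projected family are projections of joins. [this work] -/
theorem joins_image_sdiff_subset (P : Finset (Finset α)) (R : Finset α) :
    joins (P.image (· \ R)) ⊆ (joins P).image (· \ R) := by
  intro W hW
  obtain ⟨x, hx, y, hy, hxy, rfl⟩ := mem_joins_iff.1 hW
  obtain ⟨a, ha, rfl⟩ := mem_image.1 hx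
  obtain ⟨b, hb, rfl⟩ := mem_image.1 hy
  refine mem_image.2 ⟨a ∪ b, mem_joins_iff.2 ⟨a, ha, b, hb, ?_, rfl⟩, (union_sdiff_distrib a b R)⟩
  rintro rfl; exact hxy rfl

/-- Projection does not increase `#meets`. [this work] -/
theorem card_meets_image_sdiff_le (P : Finset (Finset α)) (R : Finset α) :
    #(meets (P.image (· \ R))) ≤ #(meets P) :=
  (card_le_card (meets_image_sdiff_subset P R)).trans card_image_le

/-- Projection does not increase `#joins`. [this work] -/
theorem card_joins_image_sdiff_le (P : Finset (Finset α)) (R : Finset α) :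
    #(joins (P.image (· \ R))) ≤ #(joins P) :=
  (card_le_card (joins_image_sdiff_subset P R)).trans card_image_le

/-- The ground set of the projected family. [this work] -/
theorem sup_image_sdiff (P : Finset (Finset α)) (R : Finset α) : (P.image (· \ R)).sup id = (P.sup id) \ R := by
  rw [sup_image]
  exact sup_sdiff_right P id R

/-- `R` is DIFFERENCE-FREE for `P` (no two distinct members have `a \ b ⊆ R`) ⟹ projection is injective on `P`. [this work] -/
theorem sdiff_injOn_of_dfree (hR : ∀ a ∈ P, ∀ b ∈ P, a ≠ b → ¬ a \ b ⊆ R) :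
    Set.InjOn (fun a : Finset α => a \ R) (P : Set (Finset α)) := by
  intro a ha b hb hab
  by_contra hne
  apply hR a (mem_coe.1 ha) b (mem_coe.1 hb) hne
  intro z hz
  obtain ⟨hza, hzb⟩ := mem_sdiff.1 hz
  by_contra hzR
  have : z ∈ a \ R := mem_sdiff.2 ⟨hza, hzR⟩
  simp only at hab
  rw [hab] at this
  exact hzb (mem_sdiff.1 this).1

/-- Difference-free projection keeps the number of members. [this work] -/
theorem card_image_sdiff_of_dfree (hR : ∀ a ∈ P, ∀ b ∈ P, a ≠ b → ¬ a \ b ⊆ R) : #(P.image (· \ R)) = #P :=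
  card_image_of_injOn (sdiff_injOn_of_dfree hR)

/-- Difference-free projection keeps the antichain property. [this work] -/
theorem isAntichain_image_sdiff_of_dfree (hR : ∀ a ∈ P, ∀ b ∈ P, a ≠ b → ¬ a \ b ⊆ R) :
    IsAntichain (· ⊆ ·) (P.image (· \ R) : Set (Finset α)) := by
  intro x hx y hy hxy hsub
  obtain ⟨a, ha, rfl⟩ := mem_image.1 (mem_coe.1 hx)
  obtain ⟨b, hb, rfl⟩ := mem_image.1 (mem_coe.1 hy)
  have hne : a ≠ b := by rintro rfl; exact hxy rfl
  apply hR a ha b hb hne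
  intro z hz
  obtain ⟨hza, hzb⟩ := mem_sdiff.1 hz
  by_contra hzR
  exact hzb (mem_sdiff.1 (hsub (mem_sdiff.2 ⟨hza, hzR⟩))).1

/-- **V5 transfers along a difference-free projection.**  If `R` contains no difference of two distinct members and the projected
family satisfies V5, so does `P`. [this work] -/
theorem two_mul_card_le_of_image_sdiff (hR : ∀ a ∈ P, ∀ b ∈ P, a ≠ b → ¬ a \ b ⊆ R)
    (h : 2 * #(P.image (· \ R)) ≤ #(meets (P.image (· \ R))) + #(joins (P.image (· \ R))) + 2) :
    2 * #P ≤ #(meets P) + #(joins P) + 2 := by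
  have h1 := card_meets_image_sdiff_le P R
  have h2 := card_joins_image_sdiff_le P R
  rw [card_image_sdiff_of_dfree hR] at h
  omega

/-- In an antichain a difference `a \ b` of distinct members is nonempty, so `a \ b ⊆ {r}` means `a \ b = {r}`. [this work] -/
theorem sdiff_subset_singleton_iff (hanti : IsAntichain (· ⊆ ·) (P : Set (Finset α))) {a b : Finset α} (ha : a ∈ P) (hb : b ∈ P)
    (hab : a ≠ b) (r : α) : a \ b ⊆ {r} ↔ a \ b = {r} := by
  constructor
  · intro h
    rcases subset_singleton_iff.1 h with h0 | h1
    · exact absurd (sdiff_eq_empty_iff_subset.1 h0) (hanti (mem_coe.2 ha) (mem_coe.2 hb) hab)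
    · exact h1
  · intro h; rw [h]

/-- For an antichain, `{r}` is difference-free iff no two members have `a \ b = {r}`. [this work] -/
theorem dfree_singleton_iff (hanti : IsAntichain (· ⊆ ·) (P : Set (Finset α))) (r : α) :
    (∀ a ∈ P, ∀ b ∈ P, a ≠ b → ¬ a \ b ⊆ {r}) ↔ ∀ a ∈ P, ∀ b ∈ P, a ≠ b → a \ b ≠ {r} := by
  constructor
  · intro h a ha b hb hab heq
    exact h a ha b hb hab (heq ▸ subset_refl _)
  · intro h a ha b hb hab hsub
    exact h a ha b hb hab ((sdiff_subset_singleton_iff hanti ha hb hab r).1 hsub)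

/-- `a \ b = {r}` unpacked: `r ∈ a`, `r ∉ b`, and `a.erase r ⊆ b` — the member `a ∋ r` sits, but for the point `r`, inside the
member `b ∌ r` (so `a.erase r = a ∩ b` is a cross meet at `r` and `b ∪ {r} = a ∪ b` a cross join). [this work] -/
theorem sdiff_eq_singleton_iff {a b : Finset α} {r : α} :
    a \ b = {r} ↔ r ∈ a ∧ r ∉ b ∧ a.erase r ⊆ b := by
  constructor
  · intro h
    have hr : r ∈ a \ b := by rw [h]; exact mem_singleton_self r
    refine ⟨(mem_sdiff.1 hr).1, (mem_sdiff.1 hr).2, ?_⟩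
    intro z hz
    obtain ⟨hzr, hza⟩ := mem_erase.1 hz
    by_contra hzb
    have : z ∈ a \ b := mem_sdiff.2 ⟨hza, hzb⟩
    rw [h] at this
    exact hzr (mem_singleton.1 this)
  · rintro ⟨hra, hrb, hsub⟩
    ext z
    simp only [mem_sdiff, mem_singleton]
    constructor
    · rintro ⟨hza, hzb⟩
      by_contra hzr
      exact hzb (hsub (mem_erase.2 ⟨hzr, hza⟩))
    · rintro rfl; exact ⟨hra, hrb⟩

/-- **Dichotomy at a point of the ground set** (the reduction step).  For an antichain `P` and a point `r`, either `{r}` is a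
difference of two members (`a \ b = {r}`), or the projection `a ↦ a.erase r` is injective on `P` with an antichain image on the
ground set `(P.sup id).erase r`, and `#meets`, `#joins` do not increase; in the second case V5 for the image implies V5 for `P`
(`two_mul_card_le_of_image_sdiff` with `R = {r}`, as `a \ {r} = a.erase r`). [this work] -/
theorem exists_sdiff_eq_singleton_or_dfree (hanti : IsAntichain (· ⊆ ·) (P : Set (Finset α))) (r : α) :
    (∃ a ∈ P, ∃ b ∈ P, a \ b = {r}) ∨ (∀ a ∈ P, ∀ b ∈ P, a ≠ b → ¬ a \ b ⊆ {r}) := by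
  by_cases h : ∃ a ∈ P, ∃ b ∈ P, a \ b = {r}
  · exact Or.inl h
  · right
    rw [dfree_singleton_iff hanti]
    intro a ha b hb _ heq
    exact h ⟨a, ha, b, hb, heq⟩

/-- `sdiff` by a singleton is `erase`, as families. [this work] -/
theorem image_sdiff_singleton_eq_image_erase (P : Finset (Finset α)) (r : α) :
    P.image (· \ ({r} : Finset α)) = P.image (·.erase r) := by
  apply image_congr
  intro a _
  simp only [sdiff_singleton_eq_erase]

/-- The `r`-side translate: if every member contains `r`, erasing `r` keeps `#meets` … [this work] -/
theorem card_meets_image_erase (h : ∀ a ∈ P, r ∈ a) : #(meets (P.image (·.erase r))) = #(meets P) := by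
  -- `meets (image) = (meets P).image (erase r)` and `erase r` is injective on sets containing `r`
  have hsub : meets (P.image (·.erase r)) = (meets P).image (·.erase r) := by
    apply Subset.antisymm
    · rw [← image_sdiff_singleton_eq_image_erase]
      refine (meets_image_sdiff_subset P {r}).trans (subset_of_eq ?_)
      apply image_congr; intro a _; simp only [sdiff_singleton_eq_erase]
    · intro Z hZ
      obtain ⟨V, hV, rfl⟩ := mem_image.1 hZ
      obtain ⟨a, ha, b, hb, hab, rfl⟩ := mem_meets_iff.1 hV
      refine mem_meets_iff.2 ⟨a.erase r, mem_image.2 ⟨a, ha, rfl⟩, b.erase r, mem_image.2 ⟨b, hb, rfl⟩, ?_, ?_⟩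
      · intro he
        apply hab
        rw [← insert_erase (h a ha), he, insert_erase (h b hb)]
      · ext z; simp only [mem_erase, mem_inter]; tauto
  rw [hsub]
  apply card_image_of_injOn
  intro V hV W hW hVW
  obtain ⟨a, ha, b, hb, _, rfl⟩ := mem_meets_iff.1 (mem_coe.1 hV)
  obtain ⟨c, hc, d, hd, _, rfl⟩ := mem_meets_iff.1 (mem_coe.1 hW)
  have h1 : r ∈ a ∩ b := mem_inter.2 ⟨h a ha, h b hb⟩
  have h2 : r ∈ c ∩ d := mem_inter.2 ⟨h c hc, h d hd⟩
  simp only at hVW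
  rw [← insert_erase h1, hVW, insert_erase h2]

/-- … and `#joins`. [this work] -/
theorem card_joins_image_erase (h : ∀ a ∈ P, r ∈ a) : #(joins (P.image (·.erase r))) = #(joins P) := by
  have hsub : joins (P.image (·.erase r)) = (joins P).image (·.erase r) := by
    apply Subset.antisymm
    · rw [← image_sdiff_singleton_eq_image_erase]
      refine (joins_image_sdiff_subset P {r}).trans (subset_of_eq ?_)
      apply image_congr; intro a _; simp only [sdiff_singleton_eq_erase]
    · intro W hW
      obtain ⟨V, hV, rfl⟩ := mem_image.1 hW
      obtain ⟨a, ha, b, hb, hab, rfl⟩ := mem_joins_iff.1 hV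
      refine mem_joins_iff.2 ⟨a.erase r, mem_image.2 ⟨a, ha, rfl⟩, b.erase r, mem_image.2 ⟨b, hb, rfl⟩, ?_, ?_⟩
      · intro he
        apply hab
        rw [← insert_erase (h a ha), he, insert_erase (h b hb)]
      · rw [erase_union_distrib]
  rw [hsub]
  apply card_image_of_injOn
  intro V hV W hW hVW
  obtain ⟨a, ha, b, hb, _, rfl⟩ := mem_joins_iff.1 (mem_coe.1 hV)
  obtain ⟨c, hc, d, hd, _, rfl⟩ := mem_joins_iff.1 (mem_coe.1 hW)
  have h1 : r ∈ a ∪ b := mem_union_left _ (h a ha)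
  have h2 : r ∈ c ∪ d := mem_union_left _ (h c hc)
  simp only at hVW
  rw [← insert_erase h1, hVW, insert_erase h2]

/-- The `r`-side of a split, translated to the ground set without `r`: same size, antichain, same `#meets`, `#joins`. [this work] -/
theorem card_meets_image_erase_above (P : Finset (Finset α)) (r : α) :
    #(meets ((above P r).image (·.erase r))) = #(meets (above P r)) ∧
      #(joins ((above P r).image (·.erase r))) = #(joins (above P r)) ∧ #((above P r).image (·.erase r)) = #(above P r) := by
  have h : ∀ a ∈ above P r, r ∈ a := fun a ha => (mem_above_iff.1 ha).2
  refine ⟨card_meets_image_erase h, card_joins_image_erase h, card_image_of_injOn ?_⟩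
  intro a ha b hb hab
  simp only at hab
  rw [← insert_erase (h a (mem_coe.1 ha)), hab, insert_erase (h b (mem_coe.1 hb))]

/-- The translated `r`-side of an antichain is an antichain. [this work] -/
theorem isAntichain_image_erase_above (hanti : IsAntichain (· ⊆ ·) (P : Set (Finset α))) (r : α) :
    IsAntichain (· ⊆ ·) ((above P r).image (·.erase r) : Set (Finset α)) := by
  intro x hx y hy hxy hsub
  obtain ⟨a, ha, rfl⟩ := mem_image.1 (mem_coe.1 hx)
  obtain ⟨b, hb, rfl⟩ := mem_image.1 (mem_coe.1 hy)
  obtain ⟨haP, hra⟩ := mem_above_iff.1 ha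
  obtain ⟨hbP, hrb⟩ := mem_above_iff.1 hb
  have hne : a ≠ b := by rintro rfl; exact hxy rfl
  refine hanti (mem_coe.2 haP) (mem_coe.2 hbP) hne ?_
  intro z hz
  by_cases hzr : z = r
  · rw [hzr]; exact hrb
  · exact (mem_erase.1 (hsub (mem_erase.2 ⟨hzr, hz⟩))).2

end Project

end Summit.CriticalPhenomena.PercolationContinuityZ3.Theorems.SahiColouredDaykin
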